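import Summits.Ventures.PercRepro.RLSRuleTriangleDemand
import Summits.Ventures.PercRepro.RLSZeroWorldT0K
import Summits.Ventures.PercRepro.RLSZeroWorldT1E
import Summits.Ventures.PercRepro.RLSPlanesT2_1
import Summits.Ventures.PercRepro.RLSPlanesT3_1
import Summits.Ventures.PercRepro.RLSSmallP

/-!
# C-025 at q = 3: `R₃⁺` on the triangle plane at EVERY type on the core (night-3, gen 4)

`perFlat_triangle_t0` (`U0.t0_tri6`, demand `39`), `perFlat_triangle_t1` (`W1.t1_tri6`, demand `38`),
`perFlat_triangle_t2` (demand `32`: `U2.Planes1.plane13_t2` for `n ≥ 6`, `SmallP.plane13_t2_n5 / n4`),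
`perFlat_triangle_t3` (`U3.Planes1.plane13_t3`, demand `14`), **`perFlat_triangle_all`**.
Imports `RLSRuleTriangleDemand`, `RLSZeroWorldT0K`, `RLSZeroWorldT1E`, `RLSPlanesT2_1`, `RLSPlanesT3_1`, `RLSSmallP`.  Axioms: standard.
-/

open scoped Matroid

namespace PercRepro

namespace NightThree

open Finset ThmH PerFlat

variable {α : Type*} [DecidableEq α] {M : Matroid α} [M.Finite]

/-- A choice of good triples for a set of lines of `G` (the coplanar triple of the line if it exists, any triple
else). -/
theorem exists_good_choice_of_lines {G K : Finset α} {L : Finset (Finset α)} (hG : G ∈ flatsQ M 3)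
    (hL : ∀ ℓ ∈ L, ℓ ⊆ G ∧ ℓ.card = 3 ∧ M.eRk (ℓ : Set α) = 2)
    (hKsub : K ⊆ gr M \ G) (hKind : M.Indep (K : Set α)) (hK3 : 3 ≤ K.card) :
    ∃ C : Finset α → Finset α, (∀ ℓ ∈ L, C ℓ ⊆ K ∧ (C ℓ).card = 3) ∧
      ∀ ℓ ∈ L, ∀ X, ¬ C ℓ ⊆ X → GoodWitness M ℓ K X := by
  classical
  have hex : ∀ ℓ ∈ L, ∃ C : Finset α, C ⊆ K ∧ C.card = 3 ∧ ∀ X, ¬ C ⊆ X → GoodWitness M ℓ K X := by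
    intro ℓ hℓ
    exact exists_good_triple hG (hL ℓ hℓ).1 (hL ℓ hℓ).2.2 hKsub hKind hK3
  refine ⟨fun ℓ => if hℓ : ℓ ∈ L then Classical.choose (hex ℓ hℓ) else ∅, ?_, ?_⟩
  · intro ℓ hℓ
    simp only [dif_pos hℓ]
    exact ⟨(Classical.choose_spec (hex ℓ hℓ)).1, (Classical.choose_spec (hex ℓ hℓ)).2.1⟩
  · intro ℓ hℓ X hX
    simp only [dif_pos hℓ] at hX
    exact (Classical.choose_spec (hex ℓ hℓ)).2.2 X hX

/-- The rank of `M` on the core bounds `ρ(E ∖ G) + 1` at types `t ≥ 2`. -/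
theorem eRk_compl_add_one_lt_of_core {G : Finset α} {n e : ℕ} (hc : Core M (n + 4))
    (hK : M.eRk ((gr M \ G : Finset α) : Set α) = (e : ℕ∞)) (he : e + 2 ≤ n + 4) :
    M.eRk ((gr M \ G : Finset α) : Set α) + 1 < M.eRank := by
  rw [hK, hc.2.1]
  calc (e : ℕ∞) + 1 = ((e + 1 : ℕ) : ℕ∞) := by push_cast; ring
    _ < ((n + 4 : ℕ) : ℕ∞) := by exact_mod_cast (by omega : e + 1 < n + 4)

/-- **`t = 0`**: all three lines charged, `U0.t0_tri6`. -/
theorem perFlat_triangle_t0 {G : Finset α} {L : Finset (Finset α)} {n : ℕ} (hc : Core M (n + 4))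
    (hG : G ∈ flatsQ M 3) (h : Triangle M G L) (hn : 4 ≤ n)
    (hK : ((n + 4 : ℕ) : ℕ∞) ≤ M.eRk ((gr M \ G : Finset α) : Set α)) :
    phiK (n + 4) 3 * ((UqG M (n + 4) 3 G).card : ℚ) ≤ ∑ S ∈ Yq M (n + 4) 3, wPlus M G S := by
  classical
  obtain ⟨K, hKsub, hKind, hKcard⟩ := exists_indep_compl_card G hK
  obtain ⟨C, hC, hgood⟩ := exists_good_choice_of_lines hG h.2.2.1 hKsub hKind (by omega)
  have hsup := triangle_supply hc hG h hKsub hKind (n := n) (N := n + 1) (by omega) (by omega) C hC hgood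
  have e0 : ∑ X ∈ witnessFamily K n, 1 / (((3 + X.card).choose 3 : ℕ) : ℚ) = U0.z0Sum n := by
    rw [sum_witnessFamily K n (fun x => 1 / (((3 + x).choose 3 : ℕ) : ℚ)), hKcard]
    unfold U0.z0Sum; apply Finset.sum_congr rfl; intro i _; rw [show 3 + (i + 1) = i + 4 by omega]; ring
  have e1 : ∑ X ∈ witnessFamily K n, 1 / (((4 + X.card).choose 3 : ℕ) : ℚ) = U0.z1Sum n := by
    rw [sum_witnessFamily K n (fun x => 1 / (((4 + x).choose 3 : ℕ) : ℚ)), hKcard]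
    unfold U0.z1Sum; apply Finset.sum_congr rfl; intro i _; rw [show 4 + (i + 1) = i + 5 by omega]; ring
  have e2 : ∑ X ∈ witnessFamily K n, 1 / (((5 + X.card).choose 3 : ℕ) : ℚ) = U0.z2Sum n := by
    rw [sum_witnessFamily K n (fun x => 1 / (((5 + x).choose 3 : ℕ) : ℚ)), hKcard]
    unfold U0.z2Sum; apply Finset.sum_congr rfl; intro i _; rw [show 5 + (i + 1) = i + 6 by omega]; ring
  have eW : ∑ _X ∈ witnessFamily K n, (1 : ℚ) = U0.w0Sum n := by
    rw [sum_witnessFamily K n (fun _ => (1 : ℚ)), hKcard]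
    unfold U0.w0Sum; apply Finset.sum_congr rfl; intro i _; ring
  have l1 : ∑ j ∈ range (n - 2), ((n + 1).choose j : ℚ) * (1 / (((4 + (j + 3)).choose 3 : ℕ) : ℚ)) = U0.lost4Sum n := by
    unfold U0.lost4Sum; apply Finset.sum_congr rfl; intro j _; rw [show 4 + (j + 3) = j + 7 by omega]; ring
  have l2 : ∑ j ∈ range (n - 2), ((n + 1).choose j : ℚ) * (1 / (((5 + (j + 3)).choose 3 : ℕ) : ℚ)) = U0.lost5Sum n := by
    unfold U0.lost5Sum; apply Finset.sum_congr rfl; intro j _; rw [show 5 + (j + 3) = j + 8 by omega]; ring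
  have lW : ∑ j ∈ range (n - 2), ((n + 1).choose j : ℚ) * (1 : ℚ) = U0.lostSum n := by
    unfold U0.lostSum; apply Finset.sum_congr rfl; intro j _; ring
  rw [e0, e1, e2, eW, l1, l2, lW] at hsup
  have hdem : ((UqG M (n + 4) 3 G).card : ℚ) ≤ 39 := by exact_mod_cast card_UqG_le_triangle_t0 h
  have hphi : phiK (n + 4) 3 = ∑ i ∈ range n, ((n + 4).choose (i + 1) : ℚ) / ((i + 4).choose 3 : ℚ) := by
    unfold phiK; rw [phiW_eq_phiK_form n]; rfl
  have hcert := U0.t0_tri6 n hn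
  rw [← hphi] at hcert
  calc phiK (n + 4) 3 * ((UqG M (n + 4) 3 G).card : ℚ)
      ≤ phiK (n + 4) 3 * 39 := mul_le_mul_of_nonneg_left hdem (phiK_nonneg _ _)
    _ ≤ ∑ S ∈ Yq M (n + 4) 3, wPlus M G S := by linarith

/-- **`t = 1`**: all three lines charged, `W1.t1_tri6`. -/
theorem perFlat_triangle_t1 {G : Finset α} {L : Finset (Finset α)} {n : ℕ} (hc : Core M (n + 4))
    (hG : G ∈ flatsQ M 3) (h : Triangle M G L) (hn : 4 ≤ n)
    (hK : M.eRk ((gr M \ G : Finset α) : Set α) = ((n + 3 : ℕ) : ℕ∞)) :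
    phiK (n + 4) 3 * ((UqG M (n + 4) 3 G).card : ℚ) ≤ ∑ S ∈ Yq M (n + 4) 3, wPlus M G S := by
  classical
  obtain ⟨K, hKsub, hKind, hKcard⟩ := exists_indep_compl_card G (p := n + 3) (le_of_eq hK.symm)
  obtain ⟨C, hC, hgood⟩ := exists_good_choice_of_lines hG h.2.2.1 hKsub hKind (by omega)
  have hsup := triangle_supply hc hG h hKsub hKind (n := n) (N := n) hKcard (by omega) C hC hgood
  have e0 := sum_witness_eq_t1z0 hKcard
  have e1 : ∑ X ∈ witnessFamily K n, 1 / (((4 + X.card).choose 3 : ℕ) : ℚ) = W1.t1z1Sum n := by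
    rw [sum_witnessFamily K n (fun x => 1 / (((4 + x).choose 3 : ℕ) : ℚ)), hKcard]
    unfold W1.t1z1Sum; apply Finset.sum_congr rfl; intro i _; rw [show 4 + (i + 1) = i + 5 by omega]; ring
  have e2 : ∑ X ∈ witnessFamily K n, 1 / (((5 + X.card).choose 3 : ℕ) : ℚ) = W1.t1z2Sum n := by
    rw [sum_witnessFamily K n (fun x => 1 / (((5 + x).choose 3 : ℕ) : ℚ)), hKcard]
    unfold W1.t1z2Sum; apply Finset.sum_congr rfl; intro i _; rw [show 5 + (i + 1) = i + 6 by omega]; ring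
  have eW : ∑ _X ∈ witnessFamily K n, (1 : ℚ) = U1.w1Sum n := by
    rw [sum_witnessFamily K n (fun _ => (1 : ℚ)), hKcard]
    unfold U1.w1Sum; apply Finset.sum_congr rfl; intro i _; ring
  have l1 : ∑ j ∈ range (n - 2), (n.choose j : ℚ) * (1 / (((4 + (j + 3)).choose 3 : ℕ) : ℚ)) = W1.t1lost4Sum n := by
    unfold W1.t1lost4Sum; apply Finset.sum_congr rfl; intro j _; rw [show 4 + (j + 3) = j + 7 by omega]; ring
  have l2 : ∑ j ∈ range (n - 2), (n.choose j : ℚ) * (1 / (((5 + (j + 3)).choose 3 : ℕ) : ℚ)) = W1.t1lost5Sum n := by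
    unfold W1.t1lost5Sum; apply Finset.sum_congr rfl; intro j _; rw [show 5 + (j + 3) = j + 8 by omega]; ring
  have lW : ∑ j ∈ range (n - 2), (n.choose j : ℚ) * (1 : ℚ) = W1.t1lostSum n := by
    unfold W1.t1lostSum; apply Finset.sum_congr rfl; intro j _; ring
  rw [e0, e1, e2, eW, l1, l2, lW] at hsup
  have hdem : ((UqG M (n + 4) 3 G).card : ℚ) ≤ 38 := by exact_mod_cast card_UqG_le_triangle_t1 h hK
  have hphi : phiK (n + 4) 3 = ∑ i ∈ range n, ((n + 4).choose (i + 1) : ℚ) / ((i + 4).choose 3 : ℚ) := by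
    unfold phiK; rw [phiW_eq_phiK_form n]; rfl
  have hcert := W1.t1_tri6 n hn
  rw [← hphi] at hcert
  calc phiK (n + 4) 3 * ((UqG M (n + 4) 3 G).card : ℚ)
      ≤ phiK (n + 4) 3 * 38 := mul_le_mul_of_nonneg_left hdem (phiK_nonneg _ _)
    _ ≤ ∑ S ∈ Yq M (n + 4) 3, wPlus M G S := by linarith

/-- **`t = 2`**: no loss, demand `32`, `plane13_t2` (`n ≥ 6`) and the cells `n = 4, 5`. -/
theorem perFlat_triangle_t2 {G : Finset α} {L : Finset (Finset α)} {n : ℕ} (hc : Core M (n + 4))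
    (hG : G ∈ flatsQ M 3) (h : Triangle M G L) (hn : 4 ≤ n)
    (hK : M.eRk ((gr M \ G : Finset α) : Set α) = ((n + 2 : ℕ) : ℕ∞)) :
    phiK (n + 4) 3 * ((UqG M (n + 4) 3 G).card : ℚ) ≤ ∑ S ∈ Yq M (n + 4) 3, wPlus M G S := by
  classical
  obtain ⟨K, hKsub, hKind, hKcard⟩ := exists_indep_compl_card G (p := n + 2) (le_of_eq hK.symm)
  have hlt := eRk_compl_add_one_lt_of_core hc hK (by omega)
  have hdep := depTriples_eq_of_triangle h
  have hemp : ∀ ℓ ∈ L, coplanarTriples M ℓ K = ∅ := fun ℓ hℓ =>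
    coplanarTriples_eq_empty_of_two_le hc hG (by rw [hdep]; exact hℓ) hKsub hKind hlt
  have hsup := triangle_supply_free hc hG h hKsub hKind (n := n) hemp
  have e0 : ∑ X ∈ witnessFamily K n, 1 / (((3 + X.card).choose 3 : ℕ) : ℚ) = U2.r0Sum n := by
    rw [sum_witnessFamily K n (fun x => 1 / (((3 + x).choose 3 : ℕ) : ℚ)), hKcard]
    unfold U2.r0Sum; apply Finset.sum_congr rfl; intro i _; rw [show 3 + (i + 1) = i + 4 by omega]; ring
  have e1 : ∑ X ∈ witnessFamily K n, 1 / (((4 + X.card).choose 3 : ℕ) : ℚ) = U2.r1Sum n := by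
    rw [sum_witnessFamily K n (fun x => 1 / (((4 + x).choose 3 : ℕ) : ℚ)), hKcard]
    unfold U2.r1Sum; apply Finset.sum_congr rfl; intro i _; rw [show 4 + (i + 1) = i + 5 by omega]; ring
  have e2 : ∑ X ∈ witnessFamily K n, 1 / (((5 + X.card).choose 3 : ℕ) : ℚ) = U2.r2Sum n := by
    rw [sum_witnessFamily K n (fun x => 1 / (((5 + x).choose 3 : ℕ) : ℚ)), hKcard]
    unfold U2.r2Sum; apply Finset.sum_congr rfl; intro i _; rw [show 5 + (i + 1) = i + 6 by omega]; ring
  have eW : ∑ _X ∈ witnessFamily K n, (1 : ℚ) = U2.w2Sum n := by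
    rw [sum_witnessFamily K n (fun _ => (1 : ℚ)), hKcard]
    unfold U2.w2Sum; apply Finset.sum_congr rfl; intro i _; ring
  rw [e0, e1, e2, eW] at hsup
  have hdem : ((UqG M (n + 4) 3 G).card : ℚ) ≤ 32 := by exact_mod_cast card_UqG_le_triangle_t2 h hK
  have hphi : phiK (n + 4) 3 = ∑ i ∈ range n, ((n + 4).choose (i + 1) : ℚ) / ((i + 4).choose 3 : ℚ) := by
    unfold phiK; rw [phiW_eq_phiK_form n]; rfl
  have hcert : phiK (n + 4) 3 * 32 ≤ 17 * U2.r0Sum n + 51 * U2.r1Sum n + 51 * U2.r2Sum n + 1 * U2.w2Sum n := by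
    rw [hphi]
    rcases (show n = 4 ∨ n = 5 ∨ 6 ≤ n by omega) with h4 | h5 | h6
    · subst h4; exact SmallP.plane13_t2_n4
    · subst h5; exact SmallP.plane13_t2_n5
    · exact U2.Planes1.plane13_t2 n h6
  calc phiK (n + 4) 3 * ((UqG M (n + 4) 3 G).card : ℚ)
      ≤ phiK (n + 4) 3 * 32 := mul_le_mul_of_nonneg_left hdem (phiK_nonneg _ _)
    _ ≤ ∑ S ∈ Yq M (n + 4) 3, wPlus M G S := by linarith

/-- **`t = 3`**: no loss, demand `14`, `U3.Planes1.plane13_t3`. -/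
theorem perFlat_triangle_t3 {G : Finset α} {L : Finset (Finset α)} {n : ℕ} (hc : Core M (n + 4))
    (hG : G ∈ flatsQ M 3) (h : Triangle M G L) (hn : 4 ≤ n)
    (hK : M.eRk ((gr M \ G : Finset α) : Set α) = ((n + 1 : ℕ) : ℕ∞)) :
    phiK (n + 4) 3 * ((UqG M (n + 4) 3 G).card : ℚ) ≤ ∑ S ∈ Yq M (n + 4) 3, wPlus M G S := by
  classical
  obtain ⟨K, hKsub, hKind, hKcard⟩ := exists_indep_compl_card G (p := n + 1) (le_of_eq hK.symm)
  have hlt := eRk_compl_add_one_lt_of_core hc hK (by omega)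
  have hdep := depTriples_eq_of_triangle h
  have hemp : ∀ ℓ ∈ L, coplanarTriples M ℓ K = ∅ := fun ℓ hℓ =>
    coplanarTriples_eq_empty_of_two_le hc hG (by rw [hdep]; exact hℓ) hKsub hKind hlt
  have hsup := triangle_supply_free hc hG h hKsub hKind (n := n) hemp
  have e0 : ∑ X ∈ witnessFamily K n, 1 / (((3 + X.card).choose 3 : ℕ) : ℚ) = U3.u0Sum n := by
    rw [sum_witnessFamily K n (fun x => 1 / (((3 + x).choose 3 : ℕ) : ℚ)), hKcard]
    unfold U3.u0Sum; apply Finset.sum_congr rfl; intro i _; rw [show 3 + (i + 1) = i + 4 by omega]; ring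
  have e1 : ∑ X ∈ witnessFamily K n, 1 / (((4 + X.card).choose 3 : ℕ) : ℚ) = U3.u1Sum n := by
    rw [sum_witnessFamily K n (fun x => 1 / (((4 + x).choose 3 : ℕ) : ℚ)), hKcard]
    unfold U3.u1Sum; apply Finset.sum_congr rfl; intro i _; rw [show 4 + (i + 1) = i + 5 by omega]; ring
  have e2 : ∑ X ∈ witnessFamily K n, 1 / (((5 + X.card).choose 3 : ℕ) : ℚ) = U3.u2Sum n := by
    rw [sum_witnessFamily K n (fun x => 1 / (((5 + x).choose 3 : ℕ) : ℚ)), hKcard]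
    unfold U3.u2Sum; apply Finset.sum_congr rfl; intro i _; rw [show 5 + (i + 1) = i + 6 by omega]; ring
  have eW : ∑ _X ∈ witnessFamily K n, (1 : ℚ) = U3.w3Sum n := by
    rw [sum_witnessFamily K n (fun _ => (1 : ℚ)), hKcard]
    unfold U3.w3Sum; apply Finset.sum_congr rfl; intro i _; ring
  rw [e0, e1, e2, eW] at hsup
  have hdem : ((UqG M (n + 4) 3 G).card : ℚ) ≤ 14 := by exact_mod_cast card_UqG_le_triangle_t3 hc hG h hK
  have hphi : phiK (n + 4) 3 = ∑ i ∈ range n, ((n + 4).choose (i + 1) : ℚ) / ((i + 4).choose 3 : ℚ) := by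
    unfold phiK; rw [phiW_eq_phiK_form n]; rfl
  have hcert := U3.Planes1.plane13_t3 n hn
  rw [← hphi] at hcert
  calc phiK (n + 4) 3 * ((UqG M (n + 4) 3 G).card : ℚ)
      ≤ phiK (n + 4) 3 * 14 := mul_le_mul_of_nonneg_left hdem (phiK_nonneg _ _)
    _ ≤ ∑ S ∈ Yq M (n + 4) 3, wPlus M G S := by linarith

open scoped Classical in
/-- **`R₃⁺` on the triangle plane at EVERY type**, every `p = n + 4 ≥ 8`, on a core matroid. -/
theorem perFlat_triangle_all {G : Finset α} {L : Finset (Finset α)} {n : ℕ} (hc : Core M (n + 4))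
    (hG : G ∈ flatsQ M 3) (h : Triangle M G L) (hn : 4 ≤ n) :
    phiK (n + 4) 3 * ((UqG M (n + 4) 3 G).card : ℚ) ≤ ∑ S ∈ Yq M (n + 4) 3, wPlus M G S := by
  obtain ⟨e, he, _⟩ := eRk_eq_nat M (gr M \ G)
  rcases le_or_gt (n + 4) e with h0 | h0
  · exact perFlat_triangle_t0 hc hG h hn (by rw [he]; exact_mod_cast h0)
  rcases Nat.lt_or_ge e (n + 1) with h4 | h1
  · have hdem := card_UqG_le_of_eRk_compl G (p := n + 4) (t := 4) he (by omega)
    have h0' : demandCount G.card 4 = 0 := by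
      rw [h.1]; unfold demandCount; norm_num [Finset.sum_range_succ]
    rw [h0'] at hdem
    have hU : ((UqG M (n + 4) 3 G).card : ℚ) = 0 := le_antisymm hdem (by positivity)
    rw [hU, mul_zero]
    exact Finset.sum_nonneg (fun S _ => wPlus_nonneg M G S)
  rcases (show e = n + 1 ∨ e = n + 2 ∨ e = n + 3 by omega) with h1' | h2' | h3'
  · exact perFlat_triangle_t3 hc hG h hn (by rw [he, h1'])
  · exact perFlat_triangle_t2 hc hG h hn (by rw [he, h2'])
  · exact perFlat_triangle_t1 hc hG h hn (by rw [he, h3'])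

end NightThree

end PercRepro
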